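import Summits.AtomisticToContinuum.FouriersLaw.Theorems.OddSectorIrreversibilityOddDensityIsCorrectorDetailedBalance
import Summits.AtomisticToContinuum.FouriersLaw.Theorems.OddSectorIrreversibilityOddDensityIsCorrectorCutoff

/-!
# `OpenChainGreenKubo` (stmt-AtomisticToContinuum-12696), ★ step 1a: energy cutoffs against the Gibbs weight

Helper file (`--supports`) for the support item `HonestZwanzig.OpenChainGreenKubo` (Kundu–Dhar–Narayan open-chain
Green–Kubo identity). First half of the derivative-free evaluation of `∫ L_{T+a,T+b} w dμ_T` for BOUNDED smooth `w`
(sequel: `…GibbsPairing.lean`): with the energy cutoffs `χ_R = χ(H/R)` (`χ = smoothCutoff`),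

* `integral_cutoff_mul_generator_eq` — `∫ χ_R (L_{T,T} w) dμ_T = ∫ (L_{T,T} χ_R) (w∘Θ) dμ_T` for `w ∈ C²`: the
  generator-level detailed balance `∫ (LF) k dμ_T = ∫ F (L(k∘Θ))∘Θ dμ_T` of the tree
  (`pinnedChain_integral_generator_mul_gibbsMeasure_eq_reversal`) with `F = χ_R`, `k = w∘Θ` — no derivative of `w` survives;
* `integral_cutoff_mul_partialP_partialP_mul_gibbsDensity` (and `…_gibbsMeasure`) —
  `∫ χ_R ∂²_{p_i}w ρ_T = T⁻² ∫ w χ_R (p_i² - T) ρ_T + T⁻¹ ∫ w (T∂²_{p_i}χ_R - 2p_i∂_{p_i}χ_R) ρ_T` (symmetric bath identity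
  plus one Gaussian integration by parts);
* `tendsto_integral_cutoff_mul` — `∫ χ_R f dμ → ∫ f dμ` (dominated convergence), `tendsto_zero_of_abs_le_div`.

No definitions.
-/

noncomputable section

open MeasureTheory Filter Topology Set Function
open scoped ContDiff BigOperators

namespace Summit.AtomisticToContinuum.FouriersLaw.Theorems.OpenChainGreenKubo

open Literature.MathematicalPhysics.KineticTheory.HeatConduction
open Literature.MathematicalPhysics.KineticTheory
open Summit.AtomisticToContinuum.FouriersLaw.Theorems.OddSectorIrreversibility

variable {N : ℕ}

section Pinned

variable {ω₂ lam β γ : ℝ} (hω : 0 < ω₂) (hl : 0 ≤ lam) (hβ : 0 ≤ β) {T : ℝ} (hT : 0 < T)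

/-! ### The equilibrium part against a cutoff: `∫ χ_R (L_{T,T} w) dμ_T = ∫ (L_{T,T} χ_R) (w∘Θ) dμ_T` -/

include hω hl hβ in
/-- **Detailed balance moves the equilibrium generator onto the cutoff**: for `w ∈ C²` and the energy cutoff
`χ_R = χ(H/R)`, `∫ χ_R · (L_{T,T} w) dμ_T = ∫ (L_{T,T} χ_R) · (w∘Θ) dμ_T` (`T ≠ 0`). [folklore] -/
theorem integral_cutoff_mul_generator_eq (hT0 : T ≠ 0) (R : ℝ) (hR : 0 < R) {w : PhaseSpace N → ℝ}
    (hw : ContDiff ℝ 2 w) :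
    ∫ x, smoothCutoff ((pinnedChain ω₂ lam β γ).hamiltonian N x / R) *
        (pinnedChain ω₂ lam β γ).generator N T T w x ∂((pinnedChain ω₂ lam β γ).gibbsMeasure N T) =
      ∫ x, (pinnedChain ω₂ lam β γ).generator N T T
          (fun y => smoothCutoff ((pinnedChain ω₂ lam β γ).hamiltonian N y / R)) x * w (x.1, -x.2)
        ∂((pinnedChain ω₂ lam β γ).gibbsMeasure N T) := by
  set P := pinnedChain ω₂ lam β γ with hP
  -- `k = w ∘ Θ` is `C²`
  set A : PhaseSpace N →L[ℝ] PhaseSpace N :=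
    (ContinuousLinearMap.id ℝ (Fin N → ℝ)).prodMap (-(ContinuousLinearMap.id ℝ (Fin N → ℝ))) with hA_def
  have hA : ∀ y : PhaseSpace N, A y = (y.1, -y.2) := fun y => by simp [hA_def, Prod.map]
  have hk : ContDiff ℝ 2 fun y : PhaseSpace N => w (y.1, -y.2) := by
    have e : (fun y : PhaseSpace N => w (y.1, -y.2)) = fun y => w (A y) := by funext y; rw [hA]
    rw [e]; exact hw.comp A.contDiff
  have hχ : ContDiff ℝ 2 fun y : PhaseSpace N => smoothCutoff (P.hamiltonian N y / R) :=
    (contDiff_energyCutoff (ω₂ := ω₂) (lam := lam) (β := β) γ N R).of_le (by norm_cast)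
  have hχc : HasCompactSupport fun y : PhaseSpace N => smoothCutoff (P.hamiltonian N y / R) :=
    hasCompactSupport_energyCutoff hω hl hβ γ N hR
  have key := pinnedChain_integral_generator_mul_gibbsMeasure_eq_reversal ω₂ lam β γ N hT0 hχ hχc hk
  -- the right side of `key` is `∫ χ_R(x) (L w)(Θ x) dμ_T`; reverse the momenta
  have hww : (fun y : PhaseSpace N => w ((y.1, -y.2).1, -(y.1, -y.2).2)) = w := by
    funext y; simp
  rw [hww] at key
  rw [key]
  have hrev := integral_comp_reversal_gibbsMeasure P N T
    (fun x => smoothCutoff (P.hamiltonian N x / R) * P.generator N T T w x)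
  simp only [P.hamiltonian_neg_momentum] at hrev
  exact hrev.symm

end Pinned

/-! ### The bath part against a cutoff: `∫ χ_R ∂²_{p_i} w dμ_T` by one Gaussian integration by parts -/

/-- **The second momentum derivative moved onto the cutoff and the Gibbs weight** (Lebesgue form): for
`w ∈ C²`, the energy cutoff `χ_R` and any momentum `p_i`,
`∫ χ_R ∂²_{p_i}w e^{-H/T} = T⁻² ∫ w χ_R (p_i² - T) e^{-H/T} + T⁻¹ ∫ w (T ∂²_{p_i}χ_R - 2 p_i ∂_{p_i}χ_R) e^{-H/T}`
(symmetric-bath identity `∫ (T∂²χ - p∂χ) w ρ = ∫ χ (T∂²w - p∂w) ρ` plus `∫ χ p ∂w ρ = -∫ w ∂_p(χ p ρ)`).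
[folklore] -/
theorem integral_cutoff_mul_partialP_partialP_mul_gibbsDensity (P : OscillatorChain) (hU : ContDiff ℝ ∞ P.U)
    (hV : ContDiff ℝ ∞ P.V) (N : ℕ) {T : ℝ} (hT0 : T ≠ 0) (R : ℝ)
    (hχc : HasCompactSupport fun y : PhaseSpace N => smoothCutoff (P.hamiltonian N y / R))
    {w : PhaseSpace N → ℝ} (hw : ContDiff ℝ 2 w) (i : Fin N) :
    ∫ x, smoothCutoff (P.hamiltonian N x / R) * partialP i (partialP i w) x * P.gibbsDensity N T x =
      T⁻¹ ^ 2 * (∫ x, w x * smoothCutoff (P.hamiltonian N x / R) * (x.2 i ^ 2 - T) * P.gibbsDensity N T x) +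
      T⁻¹ * ∫ x, w x * (T * partialP i (partialP i (fun y => smoothCutoff (P.hamiltonian N y / R))) x -
          2 * x.2 i * partialP i (fun y => smoothCutoff (P.hamiltonian N y / R)) x) * P.gibbsDensity N T x := by
  set χ : PhaseSpace N → ℝ := fun y => smoothCutoff (P.hamiltonian N y / R) with hχdef
  set ρ : PhaseSpace N → ℝ := P.gibbsDensity N T with hρdef
  have hU1 : ContDiff ℝ 1 P.U := hU.of_le (by norm_cast)
  have hV1 : ContDiff ℝ 1 P.V := hV.of_le (by norm_cast)
  have hH : ContDiff ℝ ∞ (P.hamiltonian N) := P.contDiff_hamiltonian hU hV N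
  have hχ : ContDiff ℝ ∞ χ := contDiff_smoothCutoff.comp (hH.div_const R)
  have hχ2 : ContDiff ℝ 2 χ := hχ.of_le (by norm_cast)
  have hχd : Differentiable ℝ χ := hχ2.differentiable two_ne_zero
  have hχ1 : ContDiff ℝ 1 (partialP i χ) := contDiff_partialP hχ2 (by norm_num) i
  have hχ1d : Differentiable ℝ (partialP i χ) := hχ1.differentiable one_ne_zero
  have hwd : Differentiable ℝ w := hw.differentiable two_ne_zero
  have hw1 : ContDiff ℝ 1 (partialP i w) := contDiff_partialP hw (by norm_num) i
  have hw1d : Differentiable ℝ (partialP i w) := hw1.differentiable one_ne_zero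
  have hρc : Continuous ρ := P.continuous_gibbsDensity hU.continuous hV.continuous N T
  have hχc' : HasCompactSupport χ := hχc
  have hPχc : Continuous (partialP i χ) := hχ1.continuous
  have hPPχc : Continuous (partialP i (partialP i χ)) := continuous_partialP hχ1 one_ne_zero i
  have hPwc : Continuous (partialP i w) := hw1.continuous
  have hPPwc : Continuous (partialP i (partialP i w)) := continuous_partialP hw1 one_ne_zero i
  have hpc : Continuous fun x : PhaseSpace N => x.2 i := (continuous_apply i).comp continuous_snd
  have hPχs : HasCompactSupport (partialP i χ) := hasCompactSupport_partialP hχd hχc' i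
  have hPPχs : HasCompactSupport (partialP i (partialP i χ)) := hasCompactSupport_partialP hχ1d hPχs i
  -- (1) the symmetric-bath identity with `F = χ`, `k = w`
  have h1 := integral_bath_mul_mul_gibbsDensity P hU1 hV1 N T hT0 hχ2 hχc' hw i
  -- (2) one integration by parts: `∫ w ∂_p(χ p ρ) = -∫ (∂_p w) χ p ρ`
  have hline : ∀ x : PhaseSpace N, HasLineDerivAt ℝ (fun y => χ y * y.2 i * ρ y)
      (partialP i χ x * x.2 i * ρ x + χ x * ρ x + χ x * x.2 i * (-(x.2 i / T) * ρ x)) x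
      ((0, Pi.single i 1) : PhaseSpace N) := by
    intro x
    have hρ' := P.hasLineDerivAt_gibbsDensity (T := T) (P.hasLineDerivAt_hamiltonian_unitP N x i)
    have hχ' := hasLineDerivAt_partialP hχd i x
    have hp' : HasLineDerivAt ℝ (fun y : PhaseSpace N => y.2 i) 1 x ((0, Pi.single i 1) : PhaseSpace N) := by
      unfold HasLineDerivAt
      have : (fun t : ℝ => (x + t • ((0, Pi.single i 1) : PhaseSpace N)).2 i) = fun t => x.2 i + t := by
        funext t; simp
      rw [this]
      exact ((hasDerivAt_id' (0 : ℝ)).const_add (x.2 i)).congr_deriv (by simp)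
    unfold HasLineDerivAt at hρ' hχ' hp' ⊢
    have := (hχ'.mul hp').mul hρ'
    simp only [zero_smul, add_zero, Pi.mul_apply, mul_one] at this
    refine this.congr_deriv ?_
    ring
  have e := integral_mul_eq_neg_of_hasLineDerivAt (v := ((0, Pi.single i 1) : PhaseSpace N))
    (F := w) (F' := partialP i w) (g := fun y => χ y * y.2 i * ρ y)
    (g' := fun x => partialP i χ x * x.2 i * ρ x + χ x * ρ x + χ x * x.2 i * (-(x.2 i / T) * ρ x))
    hw.continuous hPwc (by fun_prop) (by fun_prop) (hχc'.mul_right.mul_right) ?_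
    (fun x => hasLineDerivAt_partialP hwd i x) hline
  swap
  · exact ((hPχs.mul_right.mul_right).add (hχc'.mul_right)).add (hχc'.mul_right.mul_right)
  -- named integrals
  have iA : Integrable fun x => w x * (T * partialP i (partialP i χ) x) * ρ x :=
    ((hw.continuous.mul (continuous_const.mul hPPχc)).mul hρc).integrable_of_hasCompactSupport
      (hPPχs.mul_left.mul_left.mul_right)
  have iB : Integrable fun x => w x * (x.2 i * partialP i χ x) * ρ x :=
    ((hw.continuous.mul (hpc.mul hPχc)).mul hρc).integrable_of_hasCompactSupport
      (hPχs.mul_left.mul_left.mul_right)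
  have iC : Integrable fun x => w x * χ x * ρ x :=
    ((hw.continuous.mul hχ.continuous).mul hρc).integrable_of_hasCompactSupport (hχc'.mul_left.mul_right)
  have iD : Integrable fun x => w x * χ x * x.2 i ^ 2 * ρ x :=
    (((hw.continuous.mul hχ.continuous).mul (hpc.pow 2)).mul hρc).integrable_of_hasCompactSupport
      (hχc'.mul_left.mul_right.mul_right)
  have iX : Integrable fun x => χ x * (T * partialP i (partialP i w) x) * ρ x :=
    ((hχ.continuous.mul (continuous_const.mul hPPwc)).mul hρc).integrable_of_hasCompactSupport
      (hχc'.mul_right.mul_right)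
  have iY : Integrable fun x => χ x * (x.2 i * partialP i w x) * ρ x :=
    ((hχ.continuous.mul (hpc.mul hPwc)).mul hρc).integrable_of_hasCompactSupport (hχc'.mul_right.mul_right)
  -- rewrite (1): `A - B = X' - Y`
  have h1' : (∫ x, w x * (T * partialP i (partialP i χ) x) * ρ x) - ∫ x, w x * (x.2 i * partialP i χ x) * ρ x =
      (∫ x, χ x * (T * partialP i (partialP i w) x) * ρ x) - ∫ x, χ x * (x.2 i * partialP i w x) * ρ x := by
    rw [← integral_sub iA iB, ← integral_sub iX iY]
    have eL : (fun x => (T * partialP i (partialP i χ) x - x.2 i * partialP i χ x) * w x * ρ x) =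
        fun x => w x * (T * partialP i (partialP i χ) x) * ρ x - w x * (x.2 i * partialP i χ x) * ρ x := by
      funext x; ring
    have eR : (fun x => χ x * (T * partialP i (partialP i w) x - x.2 i * partialP i w x) * ρ x) =
        fun x => χ x * (T * partialP i (partialP i w) x) * ρ x - χ x * (x.2 i * partialP i w x) * ρ x := by
      funext x; ring
    rw [← eL, ← eR]
    exact h1
  -- rewrite (2): `B + C - D/T = -Y`
  have h2' : (∫ x, w x * (x.2 i * partialP i χ x) * ρ x) + (∫ x, w x * χ x * ρ x) -
      T⁻¹ * ∫ x, w x * χ x * x.2 i ^ 2 * ρ x = -∫ x, χ x * (x.2 i * partialP i w x) * ρ x := by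
    have eg : (fun x => w x * (partialP i χ x * x.2 i * ρ x + χ x * ρ x + χ x * x.2 i * (-(x.2 i / T) * ρ x))) =
        fun x => w x * (x.2 i * partialP i χ x) * ρ x + w x * χ x * ρ x -
          T⁻¹ * (w x * χ x * x.2 i ^ 2 * ρ x) := by
      funext x; field_simp; ring
    have eY : (fun x => partialP i w x * (χ x * x.2 i * ρ x)) = fun x => χ x * (x.2 i * partialP i w x) * ρ x := by
      funext x; ring
    have iBC : Integrable fun x => w x * (x.2 i * partialP i χ x) * ρ x + w x * χ x * ρ x := iB.add iC
    have iD' : Integrable fun x => T⁻¹ * (w x * χ x * x.2 i ^ 2 * ρ x) := iD.const_mul _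
    rw [eg, eY, integral_sub iBC iD', integral_add iB iC, integral_const_mul] at e
    exact e
  -- the target, in the same letters
  have eLHS : (fun x => χ x * partialP i (partialP i w) x * ρ x) =
      fun x => T⁻¹ * (χ x * (T * partialP i (partialP i w) x) * ρ x) := by
    funext x; field_simp
  have eR1 : (fun x => w x * χ x * (x.2 i ^ 2 - T) * ρ x) =
      fun x => w x * χ x * x.2 i ^ 2 * ρ x - T * (w x * χ x * ρ x) := by
    funext x; ring
  have eR2 : (fun x => w x * (T * partialP i (partialP i χ) x - 2 * x.2 i * partialP i χ x) * ρ x) =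
      fun x => w x * (T * partialP i (partialP i χ) x) * ρ x - 2 * (w x * (x.2 i * partialP i χ x) * ρ x) := by
    funext x; ring
  rw [eLHS, integral_const_mul, eR1, integral_sub iD (iC.const_mul T), integral_const_mul, eR2,
    integral_sub iA (iB.const_mul 2), integral_const_mul]
  -- pure algebra in the six integrals
  set A := ∫ x, w x * (T * partialP i (partialP i χ) x) * ρ x
  set B := ∫ x, w x * (x.2 i * partialP i χ x) * ρ x
  set C := ∫ x, w x * χ x * ρ x
  set D := ∫ x, w x * χ x * x.2 i ^ 2 * ρ x
  set X := ∫ x, χ x * (T * partialP i (partialP i w) x) * ρ x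
  set Y := ∫ x, χ x * (x.2 i * partialP i w x) * ρ x
  have hX : X = A - 2 * B - C + T⁻¹ * D := by linarith
  rw [hX]
  field_simp
  ring


/-- The same identity for the Gibbs MEASURE `μ_T = Z⁻¹ e^{-H/T} dx`. [folklore] -/
theorem integral_cutoff_mul_partialP_partialP_gibbsMeasure (P : OscillatorChain) (hU : ContDiff ℝ ∞ P.U)
    (hV : ContDiff ℝ ∞ P.V) (N : ℕ) {T : ℝ} (hT0 : T ≠ 0) (R : ℝ)
    (hχc : HasCompactSupport fun y : PhaseSpace N => smoothCutoff (P.hamiltonian N y / R))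
    {w : PhaseSpace N → ℝ} (hw : ContDiff ℝ 2 w) (i : Fin N) :
    ∫ x, smoothCutoff (P.hamiltonian N x / R) * partialP i (partialP i w) x ∂(P.gibbsMeasure N T) =
      T⁻¹ ^ 2 * (∫ x, w x * smoothCutoff (P.hamiltonian N x / R) * (x.2 i ^ 2 - T) ∂(P.gibbsMeasure N T)) +
      T⁻¹ * ∫ x, w x * (T * partialP i (partialP i (fun y => smoothCutoff (P.hamiltonian N y / R))) x -
          2 * x.2 i * partialP i (fun y => smoothCutoff (P.hamiltonian N y / R)) x) ∂(P.gibbsMeasure N T) := by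
  rw [P.integral_gibbsMeasure, P.integral_gibbsMeasure, P.integral_gibbsMeasure,
    integral_cutoff_mul_partialP_partialP_mul_gibbsDensity P hU hV N hT0 R hχc hw i]
  ring

/-! ### Dominated convergence as the cutoff is removed -/

/-- `∫ χ_R f dμ → ∫ f dμ` as `R → ∞` for every integrable `f` and every measure (`0 ≤ χ_R ≤ 1`, `χ_R → 1`).
[folklore] -/
theorem tendsto_integral_cutoff_mul (P : OscillatorChain) (N : ℕ) (μ : Measure (PhaseSpace N))
    (hH : Continuous (P.hamiltonian N)) {f : PhaseSpace N → ℝ} (hf : Integrable f μ) :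
    Tendsto (fun R : ℝ => ∫ x, smoothCutoff (P.hamiltonian N x / R) * f x ∂μ) atTop (𝓝 (∫ x, f x ∂μ)) := by
  refine tendsto_integral_filter_of_dominated_convergence (fun x => |f x|) ?_ ?_ hf.abs ?_
  · refine Eventually.of_forall fun R => ?_
    exact ((contDiff_smoothCutoff (n := 0)).continuous.comp (hH.div_const R)).aestronglyMeasurable.mul
      hf.aestronglyMeasurable
  · refine Eventually.of_forall fun R => Eventually.of_forall fun x => ?_
    rw [Real.norm_eq_abs, abs_mul]
    have h0 := smoothCutoff_nonneg (P.hamiltonian N x / R)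
    have h1 := smoothCutoff_le_one (P.hamiltonian N x / R)
    rw [abs_of_nonneg h0]
    exact mul_le_of_le_one_left (abs_nonneg _) h1
  · refine Eventually.of_forall fun x => ?_
    have h := (tendsto_energyCutoff_atTop P N x).mul_const (f x)
    rwa [one_mul] at h

/-- Squeeze: if `|F R| ≤ K / R` for `R ≥ 1` then `F R → 0` as `R → ∞`. [folklore] -/
theorem tendsto_zero_of_abs_le_div {F : ℝ → ℝ} {K : ℝ} (h : ∀ R : ℝ, 1 ≤ R → |F R| ≤ K / R) :
    Tendsto F atTop (𝓝 0) := by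
  have hK : Tendsto (fun R : ℝ => K / R) atTop (𝓝 0) := tendsto_const_nhds.div_atTop tendsto_id
  refine squeeze_zero_norm' ?_ hK
  filter_upwards [eventually_ge_atTop (1 : ℝ)] with R hR
  rw [Real.norm_eq_abs]
  exact h R hR

end Summit.AtomisticToContinuum.FouriersLaw.Theorems.OpenChainGreenKubo

end
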